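import Literature.NumberTheory.EllipticCurves.LocalIndexIstarFormParityProofs
import Literature.NumberTheory.EllipticCurves.NeronComponentIndexTypeIVExact
import Literature.NumberTheory.EllipticCurves.NonsplitProofs
import Literature.NumberTheory.EllipticCurves.KodairaNeronSplitCyclicProofs
import Literature.NumberTheory.EllipticCurves.GlobalMinimalModelProofs
import Literature.NumberTheory.EllipticCurves.RootNumberTwistProofs
import Literature.NumberTheory.EllipticCurves.TamagawaVariableChangeProofs
import Literature.NumberTheory.EllipticCurves.TamagawaProofs
import Literature.NumberTheory.DiophantineGeometry.LocalReduction
import HarnessLib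

/-!
# Local Tamagawa numbers of explicit minimal models: unit discriminant, multiplicative with odd
# `ord Δ`, and the `I₀*`/`Iₙ*`-shaped twist model (proofs, over a Henselian DVR)

`Proofs` file (theorems only: no definition, no named fact, no instance), topic
`Literature/NumberTheory/EllipticCurves`. It packages, in the currency
`(N ⊗ K).localTamagawaNumber R = [E(K) : E₀(K)]` of `Tamagawa.lean` (an index computed on Mathlib's
chosen minimal model), the local computations of G. Boxer, P. Diao, *2-Selmer groups of quadratic
twists of elliptic curves*, Proc. AMS 138 (2010), proof of Prop. 4.1 (pp. 1976–1977), for an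
explicit `R`-model `N` of an elliptic curve over the fraction field `K` of a discrete valuation ring
`R` (Henselian with finite residue field where needed):

* `localTamagawaNumber_baseChange_eq_one_of_isUnit_Δ` — `Δ(N) ∈ Rˣ` ⇒ `c = 1` (good reduction;
  "if `(p, d) = 1`, then `E^{(d)}` has good reduction at `p` and so `c_p = 1`");
* `odd_localTamagawaNumber_baseChange_of_isUnit_c₄` — `c₄(N) ∈ Rˣ`, `Δ(N) = ϖⁿ·unit` with `n` odd
  ⇒ `c` is odd ("`c_p(E^{(d)})` is odd (it is either `1` or `v_p(Δ_E)` depending on whether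
  `E^{(d)}` has split or non-split multiplicative reduction at `p`)"): split ⇒ `c = n` by the
  Kodaira–Néron theorem for split multiplicative reduction
  (`index_goodReductionSubgroup_of_hasSplitMultiplicativeReduction_holds`), non-split ⇒ `c = 1`
  (`LocalIndex.index_of_nonsplit`);
* `localTamagawaNumber_baseChange_eq_one_of_cubic_no_root` /
  `two_dvd_localTamagawaNumber_baseChange_of_cubic_simple_root` — for a MINIMAL model in the shape
  `a₁ = ϖα, a₂ = ϖβ, a₃ = ϖ²γ, a₄ = ϖ²δ, a₆ = ϖ³ε` (the twist `y² = d³f(x/d)` at `p ∣ d`):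
  `c = 1` if `T³ + β̄T² + δ̄T + ε̄` has no root in `k`, and `2 ∣ c` if it has a simple root
  ("`c_p` is equal to `1` plus the number of roots …"; "`c_p = 2` or `4`"), from
  `LocalIndexIstarFormParityProofs`;
* the valuation of `ϖⁿ·unit`, used (with the tree's minimality criteria `v(Δ) < 12` / `v(c₄) < 4`,
  `WeierstrassCurve.isMinimal_of_exp_lt_valuation_Δ/_c₄`, Silverman *AEC* VII.1 Rem. 1.1) to certify
  the explicit models.

## References

* G. Boxer, P. Diao, *2-Selmer groups of quadratic twists of elliptic curves*, Proc. Amer. Math.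
  Soc. 138 (2010) 1969–1978, Prop. 4.1 and its proof (pp. 1976–1977). [BoxerDiao2010]
* J. H. Silverman, *The Arithmetic of Elliptic Curves*, 2nd ed. (2009), VII.1 Rem. 1.1, VII.5
  Prop. 5.1, VII.6. [SilvermanAEC2009]
* J. H. Silverman, *Advanced Topics in the Arithmetic of Elliptic Curves* (1994), IV.9.2(d),
  IV.9.4 Steps 2, 6, 7. [SilvermanATAEC1994]
-/

noncomputable section

open scoped Classical

open IsLocalRing Polynomial

namespace Literature.NumberTheory.EllipticCurves

namespace LocalIndex

variable {R : Type*} [CommRing R] [IsDomain R] [IsDiscreteValuationRing R]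
  {K : Type*} [Field K] [Algebra R K] [IsFractionRing R K]

/-! ### Valuations of `ϖⁿ · unit` -/

/-- `v(ϖⁿ u) = exp(−n)` for an irreducible `ϖ` and a unit `u` of a DVR, in the `𝔪`-adic valuation
of the fraction field: the normalised valuation `ord_v` of Silverman, *AEC* VII.1 ("`v : K* → ℤ` the
normalized valuation", `R = {x : v(x) ≥ 0}`, uniformiser of valuation `1`), in Mathlib's
multiplicative notation `exp(−ord_v)`. [cite: SilvermanAEC2009, VII.1 (normalised valuation, PDF p. 185)] -/
theorem valuation_algebraMap_pow_mul_of_isUnit {ϖ u : R} (hϖ : Irreducible ϖ) (hu : IsUnit u)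
    (n : ℕ) :
    (IsDiscreteValuationRing.maximalIdeal R).valuation K (algebraMap R K (ϖ ^ n * u)) =
      WithZero.exp (-(n : ℤ)) := by
  rw [IsDedekindDomain.HeightOneSpectrum.valuation_of_algebraMap, map_mul, map_pow,
    IsDedekindDomain.HeightOneSpectrum.intValuation_singleton _ hϖ.ne_zero
      (hϖ.maximalIdeal_eq),
    IsDedekindDomain.HeightOneSpectrum.intValuation_eq_one_iff.mpr
      (IsLocalRing.notMem_maximalIdeal.mpr hu), mul_one, ← WithZero.exp_nsmul]
  simp

/-! ### The local Tamagawa number read on an explicit minimal `R`-model -/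

/-- If `N ⊗ K` is a minimal equation of an elliptic curve, its local Tamagawa number is the index
`[N(K) : N₀(K)]` computed on `N` itself (Silverman, *AEC* VII.1.3(b), VII.6 Ex. 7.6: independence
of the minimal model). [cite: SilvermanAEC2009, VII.1 Prop. 1.3(b) and VII.6 Ex. 7.6] -/
theorem localTamagawaNumber_baseChange_eq_index (N : WeierstrassCurve R)
    [(N.baseChange K).IsElliptic] [(N.baseChange K).IsMinimal R] :
    (N.baseChange K).localTamagawaNumber R =
      (N.nonsingularReductionSubgroup (integers_valuationRing_valuation R K)).index :=
  localTamagawaNumber_eq_index_of_smul_eq_baseChange (N.baseChange K) N 1 (one_smul _ _)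

/-- **Unit discriminant ⇒ `c = 1`.** If `Δ(N) ∈ Rˣ` then `N ⊗ K` is minimal with good reduction and
every point has nonsingular reduction: `[E(K) : E₀(K)] = 1` (Silverman, *AEC* VII.5 Prop. 5.1(a)
and VII.2, remark after Prop. 2.1). Boxer–Diao 2010, proof of Prop. 4.1: "`E^{(d)}` has good
reduction at `p` and so `c_p = 1`". [cite: SilvermanAEC2009, VII.5 Prop. 5.1(a)] -/
theorem localTamagawaNumber_baseChange_eq_one_of_isUnit_Δ (N : WeierstrassCurve R)
    (hN : IsUnit N.Δ) : (N.baseChange K).localTamagawaNumber R = 1 := by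
  haveI : WeierstrassCurve.IsIntegral R (N.baseChange K) := ⟨⟨N, rfl⟩⟩
  have hval : (IsDiscreteValuationRing.maximalIdeal R).valuation K (N.baseChange K).Δ = 1 := by
    rw [WeierstrassCurve.baseChange, WeierstrassCurve.map_Δ,
      IsDedekindDomain.HeightOneSpectrum.valuation_eq_one_iff_notMem]
    exact IsLocalRing.notMem_maximalIdeal.mpr hN
  haveI hmin : (N.baseChange K).IsMinimal R :=
    WeierstrassCurve.isMinimal_of_valuation_Δ_eq_one _ hval
  haveI hgood : (N.baseChange K).HasGoodReduction R := ⟨hval⟩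
  have hΔK : (N.baseChange K).Δ ≠ 0 := by
    rw [WeierstrassCurve.baseChange, WeierstrassCurve.map_Δ]
    exact (map_ne_zero_iff _ (IsFractionRing.injective R K)).mpr hN.ne_zero
  haveI : (N.baseChange K).IsElliptic := (WeierstrassCurve.isElliptic_iff _).mpr (Ne.isUnit hΔK)
  unfold WeierstrassCurve.localTamagawaNumber
  have hidx : (((N.baseChange K).minimal R).goodReductionSubgroup R).index =
      ((N.baseChange K).goodReductionSubgroup R).index :=
    WeierstrassCurve.index_goodReductionSubgroup_eq_of_eq_smul R
      (W₂ := (N.baseChange K).minimal R)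
      (D := ((N.baseChange K).exists_isMinimal R).choose) rfl hΔK
  rw [hidx, WeierstrassCurve.goodReductionSubgroup_eq_top_of_hasGoodReduction, AddSubgroup.index_top]

/-! ### Multiplicative reduction with odd `ord Δ`: `c` is odd -/

/-- **`c₄ ∈ Rˣ`, `Δ = ϖⁿ·unit` with `n` odd ⇒ `c` odd** (Henselian `R`, finite residue field). The
model `N ⊗ K` is minimal (`v(c₄) = 0`) with multiplicative reduction; if the node-tangent polynomial
splits over `k` the reduction is split and `[E(K) : E₀(K)] = n` by the Kodaira–Néron theorem
(Silverman, *ATAEC* IV.9.2(d), the tree's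
`index_goodReductionSubgroup_of_hasSplitMultiplicativeReduction_holds`); otherwise it is non-split
and `[E(K) : E₀(K)] = 1` since `n` is odd (Silverman, *ATAEC* IV.9.4 Step 2, the tree's
`LocalIndex.index_of_nonsplit`). Boxer–Diao 2010, proof of Prop. 4.1 (p. 1976): "the Tamagawa factor
`c_p(E^{(d)})` is odd (it is either `1` or `v_p(Δ_E)` depending on whether `E^{(d)}` has split or
non-split multiplicative reduction at `p`)".
[cite: BoxerDiao2010, proof of Prop. 4.1 (p. 1976)]
[cite: SilvermanATAEC1994, Cor. IV.9.2(d) and IV.9.4 Step 2 (PDF pp. 340, 344)] -/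
theorem odd_localTamagawaNumber_baseChange_of_isUnit_c₄ [HenselianLocalRing R]
    [Finite (ResidueField R)] (N : WeierstrassCurve R) (hc₄ : IsUnit N.c₄) {ϖ u : R} {n : ℕ}
    (hϖ : Irreducible ϖ) (hu : IsUnit u) (hΔ : N.Δ = ϖ ^ n * u) (hn : Odd n) :
    Odd ((N.baseChange K).localTamagawaNumber R) := by
  haveI : PerfectField (ResidueField R) := PerfectField.ofFinite
  haveI : WeierstrassCurve.IsIntegral R (N.baseChange K) := ⟨⟨N, rfl⟩⟩
  have hinj := IsFractionRing.injective R K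
  have hΔ0 : N.Δ ≠ 0 := by
    rw [hΔ]; exact mul_ne_zero (pow_ne_zero _ hϖ.ne_zero) hu.ne_zero
  have hΔK : (N.baseChange K).Δ ≠ 0 := by
    rw [WeierstrassCurve.baseChange, WeierstrassCurve.map_Δ]
    exact (map_ne_zero_iff _ hinj).mpr hΔ0
  haveI : (N.baseChange K).IsElliptic := (WeierstrassCurve.isElliptic_iff _).mpr (Ne.isUnit hΔK)
  have hvc₄ : (IsDiscreteValuationRing.maximalIdeal R).valuation K (N.baseChange K).c₄ = 1 := by
    rw [WeierstrassCurve.baseChange, WeierstrassCurve.map_c₄,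
      IsDedekindDomain.HeightOneSpectrum.valuation_eq_one_iff_notMem]
    exact IsLocalRing.notMem_maximalIdeal.mpr hc₄
  haveI hmin : (N.baseChange K).IsMinimal R :=
    WeierstrassCurve.isMinimal_of_exp_lt_valuation_c₄ _
      (by rw [hvc₄, ← WithZero.exp_zero, WithZero.exp_lt_exp]; norm_num)
  have hvΔ : (IsDiscreteValuationRing.maximalIdeal R).valuation K (N.baseChange K).Δ =
      WithZero.exp (-(n : ℤ)) := by
    rw [WeierstrassCurve.baseChange, WeierstrassCurve.map_Δ, hΔ]
    exact valuation_algebraMap_pow_mul_of_isUnit hϖ hu n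
  have hn0 : n ≠ 0 := by rintro rfl; exact (Nat.not_odd_iff_even.mpr (Even.zero)) hn
  have hmult : (N.baseChange K).HasMultiplicativeReduction R := by
    refine (WeierstrassCurve.hasMultiplicativeReduction_iff R _).mpr ⟨hmin, ?_, hvc₄⟩
    rw [hvΔ, ← WithZero.exp_zero, WithZero.exp_lt_exp]
    omega
  -- `c = [N(K) : N₀(K)]`
  rw [localTamagawaNumber_baseChange_eq_index N]
  have hΔm : N.Δ ∈ maximalIdeal R := by
    rw [hΔ]
    exact Ideal.mul_mem_right _ _ (Ideal.pow_mem_of_mem _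
      ((IsLocalRing.mem_maximalIdeal _).mpr hϖ.not_isUnit) n (Nat.pos_of_ne_zero hn0))
  have hc₄m : N.c₄ ∉ maximalIdeal R := IsLocalRing.notMem_maximalIdeal.mpr hc₄
  by_cases hsplit : Splits (Polynomial.map (algebraMap R (ResidueField R))
      (C N.c₄ * X ^ 2 + C (N.a₁ * N.c₄) * X - C (54 * N.b₆ - 3 * N.b₂ * N.b₄ + N.a₂ * N.c₄)))
  · -- split multiplicative: Kodaira–Néron, `v(Δ) = exp(−c)`
    haveI : (N.baseChange K).HasSplitMultiplicativeReduction R := by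
      refine (WeierstrassCurve.hasSplitMultiplicativeReduction_iff R _).mpr ⟨hmult, ?_⟩
      rw [WeierstrassCurve.integralModel_baseChange_eq]
      exact hsplit
    obtain ⟨-, hkey⟩ :=
      WeierstrassCurve.index_goodReductionSubgroup_of_hasSplitMultiplicativeReduction_holds R
        (N.baseChange K)
    rw [hvΔ, WithZero.exp_inj, neg_inj, Nat.cast_inj,
      WeierstrassCurve.goodReductionSubgroup_baseChange_eq] at hkey
    rw [← hkey]; exact hn
  · -- non-split multiplicative: `c = 1` as `n` is odd
    have hns := noroot_of_not_splits N hc₄m hsplit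
    rw [index_of_nonsplit N hΔ0 hΔm hc₄m hns]
    have hval : (IsDiscreteValuationRing.addVal R N.Δ).toNat = n := by
      rw [hΔ, mul_comm, ← hu.unit_spec, IsDiscreteValuationRing.addVal_def' hu.unit hϖ n]
      rfl
    rw [hval, if_neg (Nat.not_even_iff_odd.mpr hn)]
    exact odd_one

/-! ### The `I₀*`/`Iₙ*`-shaped model: no root ⇒ `c = 1`, a simple root ⇒ `2 ∣ c` -/

/-- **No root ⇒ `c = 1`.** For a minimal `R`-model `N` of an elliptic curve with `a₁ = ϖα`,
`a₂ = ϖβ`, `a₃ = ϖ²γ`, `a₄ = ϖ²δ`, `a₆ = ϖ³ε` whose cubic `T³ + β̄T² + δ̄T + ε̄` has no root in the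
residue field, `[E(K) : E₀(K)] = 1`. Boxer–Diao 2010, proof of Prop. 4.1 (p. 1977): "`c_p` is
equal to `1` plus the number of roots of the polynomial … mod `p`" (no root).
[cite: BoxerDiao2010, proof of Prop. 4.1 (p. 1977)] [cite: SilvermanATAEC1994, IV.9.4 Step 6 (PDF p. 345)] -/
theorem localTamagawaNumber_baseChange_eq_one_of_cubic_no_root (N : WeierstrassCurve R)
    [(N.baseChange K).IsElliptic] [(N.baseChange K).IsMinimal R] {ϖ α β γ δ ε : R}
    (hϖ : Irreducible ϖ) (hα : N.a₁ = ϖ * α) (hβ : N.a₂ = ϖ * β) (hγ : N.a₃ = ϖ ^ 2 * γ)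
    (hδ : N.a₄ = ϖ ^ 2 * δ) (hε : N.a₆ = ϖ ^ 3 * ε)
    (hno : ∀ t : ResidueField R,
      t ^ 3 + residue R β * t ^ 2 + residue R δ * t + residue R ε ≠ 0) :
    (N.baseChange K).localTamagawaNumber R = 1 := by
  rw [localTamagawaNumber_baseChange_eq_index N]
  exact index_eq_one_of_forall_cubic_ne_zero N hϖ hα hβ hγ hδ hε hno

/-- **A simple root ⇒ `2 ∣ c`** (Henselian `R`). For a minimal `R`-model `N` of an elliptic curve
with `a₁ = ϖα`, `a₂ = ϖβ`, `a₃ = ϖ²γ`, `a₄ = ϖ²δ`, `a₆ = ϖ³ε` whose cubic `T³ + β̄T² + δ̄T + ε̄`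
has a simple root in the residue field, `2 ∣ [E(K) : E₀(K)]`. Boxer–Diao 2010, proof of Prop. 4.1
(p. 1977): a root of the `2`-division cubic mod `p` makes `c_p` even; type `Iₙ*`: "`c_p = 2` or
`4`". [cite: BoxerDiao2010, proof of Prop. 4.1 (p. 1977)] [cite: SilvermanATAEC1994, IV.9.4 Steps 6–7 (PDF p. 345)] -/
theorem two_dvd_localTamagawaNumber_baseChange_of_cubic_simple_root [HenselianLocalRing R]
    (N : WeierstrassCurve R) [(N.baseChange K).IsElliptic] [(N.baseChange K).IsMinimal R]
    {ϖ α β γ δ ε : R} (hϖ : Irreducible ϖ) (hα : N.a₁ = ϖ * α) (hβ : N.a₂ = ϖ * β)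
    (hγ : N.a₃ = ϖ ^ 2 * γ) (hδ : N.a₄ = ϖ ^ 2 * δ) (hε : N.a₆ = ϖ ^ 3 * ε)
    {t : ResidueField R} (ht : t ^ 3 + residue R β * t ^ 2 + residue R δ * t + residue R ε = 0)
    (ht' : 3 * t ^ 2 + 2 * residue R β * t + residue R δ ≠ 0) :
    2 ∣ (N.baseChange K).localTamagawaNumber R := by
  have hΔ : N.Δ ≠ 0 := by
    intro h0
    apply (N.baseChange K).Δ'.ne_zero
    rw [WeierstrassCurve.coe_Δ', WeierstrassCurve.baseChange, WeierstrassCurve.map_Δ, h0, map_zero]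
  rw [localTamagawaNumber_baseChange_eq_index N]
  exact two_dvd_index_of_cubic_simple_root N hϖ hα hβ hγ hδ hε hΔ ht ht'

end LocalIndex

end Literature.NumberTheory.EllipticCurves

end
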